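import Literature.Computability.Complexity.BitFormats
import HarnessLib

/-!
# Bit formats: reading at an offset of a list

Trunk T-CPLX-CORE, generic; companion of `BitFormats.lean` (read side; `BitLayoutRead.lean` is the
layout analogue). `ofListAt N l off` is the window `off … off + N - 1` of the list `l` as a bit
function (missing bits `false`; `ofList N l = ofListAt N l 0`), and the format readers decompose
over windows: `split_ofListAt` (a pair reads its components at `off` and `off + N₁`),
`block_ofListAt` (block `i` of a tuple at `off + i N`), `read_prod_ofListAt_fst/snd`,
`read_pi_ofListAt`, `read_option_ofListAt` (presence bit at `off`, payload at `off + 1`),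
`read_natB_ofListAt` (the binary value `Σ bitᵢ 2^i` of the window). Written for the App. D machine
programmes (`Literature.Barriers.PneNP.AkaviaEtAl2006_complMemAM`). All proved, [folklore].

## References

* [AroraBarakCC2009] S. Arora, B. Barak, *Computational Complexity: A Modern Approach*, CUP 2009,
  §1.2 (representing objects as strings).
-/

namespace Literature.Computability.Complexity

open Finset

namespace BitFormat

variable {α β : Type*} {N N₁ N₂ : ℕ}

/-- **A window of a list as a bit function**: bits `off … off + N - 1`, missing bits `false`. [folklore] -/
def ofListAt (N : ℕ) (l : List Bool) (off : ℕ) : Fin N → Bool := fun j => l.getD (off + j) false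

/-- The prefix is the window at `0`. [folklore] -/
theorem ofList_eq_ofListAt (N : ℕ) (l : List Bool) : ofList N l = ofListAt N l 0 := by
  funext j; simp [ofList, ofListAt]

/-- Splitting a window: the two halves are windows. [folklore] -/
@[simp] theorem split_ofListAt (l : List Bool) (off : ℕ) :
    split (ofListAt (N₁ + N₂) l off) = (ofListAt N₁ l off, ofListAt N₂ l (off + N₁)) := by
  unfold split ofListAt
  ext j <;> simp [Nat.add_assoc]

/-- Block `i` of a window of `k` blocks is the window `i N` further. [folklore] -/
@[simp] theorem block_ofListAt (k : ℕ) (l : List Bool) (off : ℕ) (i : Fin k) :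
    block k (ofListAt (k * N) l off) i = ofListAt N l (off + i * N) := by
  funext j
  simp only [block, ofListAt]
  rw [BitLayout.pi_pos, Nat.add_assoc]

/-- A pair reads its first component at the same offset. [folklore] -/
@[simp] theorem read_prod_ofListAt_fst (Φ₁ : BitFormat α N₁) (Φ₂ : BitFormat β N₂) (l : List Bool) (off : ℕ) :
    ((prod Φ₁ Φ₂).read (ofListAt (N₁ + N₂) l off)).1 = Φ₁.read (ofListAt N₁ l off) := by
  simp [prod]

/-- A pair reads its second component `N₁` bits later. [folklore] -/
@[simp] theorem read_prod_ofListAt_snd (Φ₁ : BitFormat α N₁) (Φ₂ : BitFormat β N₂) (l : List Bool) (off : ℕ) :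
    ((prod Φ₁ Φ₂).read (ofListAt (N₁ + N₂) l off)).2 = Φ₂.read (ofListAt N₂ l (off + N₁)) := by
  simp [prod]

/-- A tuple reads component `i` at `off + i N`. [folklore] -/
@[simp] theorem read_pi_ofListAt (Φ : BitFormat α N) (k : ℕ) (l : List Bool) (off : ℕ) (i : Fin k) :
    (pi Φ k).read (ofListAt (k * N) l off) i = Φ.read (ofListAt N l (off + i * N)) := by
  simp [pi]

/-- A transported format reads through the bijection. [folklore] -/
@[simp] theorem read_ofEquiv (e : β ≃ α) (Φ : BitFormat α N) (v : Fin N → Bool) : (ofEquiv e Φ).read v = e.symm (Φ.read v) := rfl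

/-- **An option reads its presence bit at `off` and its payload at `off + 1`.** [folklore] -/
theorem read_option_ofListAt (Φ : BitFormat α N) (d : α) (l : List Bool) (off : ℕ) :
    (option Φ d).read (ofListAt (1 + N) l off) = if l.getD off false then some (Φ.read (ofListAt N l (off + 1))) else none := by
  unfold option
  simp only [split_ofListAt]
  rfl

/-- **A binary number reads the value of its window.** [folklore] -/
theorem read_natB_ofListAt (b : ℕ) (l : List Bool) (off : ℕ) :
    (natB b).read (ofListAt b l off) = ∑ i : Fin b, (l.getD (off + i) false).toNat * 2 ^ (i : ℕ) := by
  unfold natB ofListAt; exact BitLayout.finPow_symm_val b _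

end BitFormat

end Literature.Computability.Complexity
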